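import Literature.MathematicalPhysics.QuantumFieldTheory.Balaban1983to89.B8Thm2SetupTorus
import Literature.MathematicalPhysics.QuantumFieldTheory.Balaban1983to89.B8Prop7ClassAkLocal
import Literature.MathematicalPhysics.QuantumFieldTheory.Balaban1983to89.B8Prop3GaugeFixedKLevel
import HarnessLib

/-!
# Route `UnitScaleTilt`, crux K1 child «MinimiserStabilityRegPr» (stmt-QuantumFields-19200), leaf V2′ (one-step halving, Sect. F) — pillar piece F2:
# **[Balaban1985RegularSpaces] PROPOSITION 7 (1.144), `𝔄_k`-CLAUSE, LOCALLY (any domain family `{Ω_j}`), AT THE SETUP TORUS** — the chart's output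
# «U^{u⁻¹} = e^{iηA} with (1.140) on Ω_j» sends the configuration back into `𝔄_k({Ω_j}, α₀ + 3α₂)`; flat-background case for Sect. F's first case ((168))

Cell `ym3-torus` (HUMAN RULING D-0037, YM ladder rung R3), seat `ym3-torus-p1` gen 14 (UV side); memo HOME/UV3-NODE.md §23.6.  `--supports stmt-QuantumFields-19200 --as helper`.
OWNER RULING g20-№8 §A3 names «F2 ([B8] (1.141)–(1.142)) — ym3-torus-p1 (the V4′ engine) or the V2 lineage inside the composition».  The `ℤᵈ` mathematics IS IN THE TREE
(lit-balaban p40 gen 5): `B8Prop7ClassAkLocal.inAk_mulCfg_gaugeAct_hermitian_loc` — for a C⋆-algebra, `A` Hermitian, `U₀` `U1`-valued, ANY family `Ω : ℕ → Set (Site d)`: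
`InAk α₀ Ω U₀` ∧ (1.140) on the `SideTouches` layers of every `Ω_j` (`B8Eq140Level.Cond140`) ∧ `0 ≤ α₀, α₂ ≤ 1/(80d)` ⇒ `InAk (α₀ + 3α₂) Ω ((e^{iηA}U₀)^u)`.
THIS FILE reads it AT THE SETUP TORUS (`GaugeField P 0 U(N)` on `Site P 0`) for a LOCAL chart: type-B8's junction `B8Thm2SetupTorus.inSpace_iff_inAk_pull` (torus class
`B10Eq68TorusRegularity.InSpace` ↔ `ℤᵈ` class `B8Ineq132.InAk` of the periodic pullback `cfgPull`), the LOCALITY `B8Prop3GaugeFixedKLevel.inAk_congr_of_sideTouches` (the class reads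
only the `SideTouches` layers), and the POINTWISE group algebra of the chart (`mulCfg_apply_eq_gaugeAct_of_mgauge_apply_eq`: where `mgauge V₀ v U′ = W`, `U′V₀ = (WV₀)^{v⁻¹}`).
* **`inSpace_mul_of_local_chart`** — `InSpace k Ω α₀ η U₀` ∧ (on the layers) `mgauge (U₀♯) (u♯)⁻¹ (U′♯) = cfgExp η A♯` (the equation of `B8Thm2SetupTorus.Concl2Setup`,
  «U₁ = U′^{u⁻¹} = e^{iηA}», RESTRICTED to the bonds the class reads) ∧ `∀ j ≤ k, Cond140 P.L η α₂ j (pullDom Ω j) (U₀♯) A♯` ∧ `A` self-adjoint ∧ `0 < α₀, α₂ ≤ 1/(80·P.d)`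
  ⇒ `InSpace k Ω (α₀ + 3α₂) η (U′·U₀)`.
* **`inSpace_of_local_chart_flat`** — the background `U₀ = 1` (Sect. F after (145)–(146): flat derivatives in (152)): `U ∈ 𝔄_k({Ω_j}, α₀ + 3α₂)` for EVERY `0 < α₀ ≤ 1/(80d)`.
At the d = 3 carrier: `P := F.P K`, `k := K − n`, `η := (L⁻¹)^{K−n}`, configurations through `B10Eq27TorusAxialLog.toUField` (`B8Thm2SetupTorus.toUField_mul`), and for the all-torus
family `T3PrintedRegularMinimiser.regPr_iff_inSpace`; for Sect. F's Δ₀ take `Ω` = the cube sequence (144) and read the level-`k` clauses on `Δ₀`.  HONEST SCOPE: the `𝔄_k`-clause only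
(not the axial-gauge clause (1.145)); the chart (F1) and the improved bounds (165) (F4) are INPUTS; constants p40's (`3α₂`, `1/(80d)`).  No definition, no sorry, standard axioms.
NOT a claim about the mass gap.

References: T. Bałaban, CMP **99** (1985) 75–102 [Balaban1985RegularSpaces] Prop. 7 (1.144) p.100, (1.7)–(1.9) p.77, (1.21) p.79; CMP **102** (1985) 277–309 [Balaban1985Variational]
Sect. F (144)–(146) pp.300–301, (152) p.302, (168) p.304; CMP **98** (1985) 17–51 [Balaban1985Averaging] (55) p.27.
-/

set_option autoImplicit false

noncomputable section

open scoped Matrix.Norms.L2Operator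

namespace Summit.QuantumFields.YangMills.Theorems.Prop7LocalChart

open Literature.MathematicalPhysics.QuantumFieldTheory.Balaban1983to89
open B7Prop1Explicit (gaugeAct U1 Site)
open B7Eq92Concrete (mgauge Rc)
open B8Lemma1NonAbelian (mulCfg)
open B8Ineq132 (InAk)
open B8Eq146AExpansion (expCfg iEta)
open B8Eq140Level (SideTouches Cond140)
open B8Eq184Proof (cfgExp)
open B8Thm2SetupTorus (cfgPull gaugePull pullDom cfgPull_mul cfgPull_mem gaugePull_mem inSpace_iff_inAk_pull)
open B8Prop3GaugeFixedKLevel (inAk_congr_of_sideTouches expCfg_iEta_eq_cfgExp)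
open B8Prop7ClassAkLocal (inAk_mulCfg_gaugeAct_hermitian_loc)
open B10Eq27TorusAxialLog (pull unitsField)
open B10Eq68TorusRegularity (InSpace)
open B7Prop2Explicit (unitaryUnits_le_U1)

variable {P : Params} {N : ℕ} [NeZero N]

/-- **POINTWISE GROUP ALGEBRA OF THE CHART**: where `v·U′·(R(V₀)v₊)⁻¹ = W` at a bond (print's gauge-fixed field «U₁ = U′^{u⁻¹}» relative to the
background, [Balaban1985Averaging] (55)), the product configuration reads `U′V₀ = (W V₀)^{v⁻¹}` at that bond. [cite: Balaban1985RegularSpaces, (1.16) p.78, (1.21) p.79] -/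
theorem mulCfg_apply_eq_gaugeAct_of_mgauge_apply_eq {G : Type*} [Group G] {d : ℕ} {V₀ W U' : Site d → Fin d → G} {v : Site d → G}
    {x : Site d} {κ : Fin d} (h : mgauge V₀ v U' x κ = W x κ) :
    mulCfg U' V₀ x κ = gaugeAct v⁻¹ (mulCfg W V₀) x κ := by
  simp only [mulCfg, gaugeAct, Pi.inv_apply, inv_inv]
  rw [← h]
  simp only [mgauge, Rc, MonoidHom.coe_mk, OneHom.coe_mk, mul_inv_rev, inv_inv]
  group

/-- **[Balaban1985RegularSpaces] PROPOSITION 7 (1.144), `𝔄_k`-CLAUSE, LOCALLY, AT THE SETUP TORUS** (`U(N)` configurations on `Site P 0`, any `Params`):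
let `Ω : ℕ → Set (Site P 0)` be any domain family on the torus, `U₀ ∈ 𝔄_k({Ω_j}, α₀)` (torus letter `B10Eq68TorusRegularity.InSpace`, (1.139)), `U′` a configuration,
`u` a torus gauge transformation and `A` a bondwise self-adjoint torus one-form such that ON THE BONDS THAT (1.7)/(1.9) READ (the `SideTouches` layers of the pulled-back
domains) the gauge-fixed field is `e^{iηA}` — `mgauge (U₀♯) (u♯)⁻¹ (U′♯) = cfgExp η A♯` there (the equation of `B8Thm2SetupTorus.Concl2Setup`, i.e. `U₁ = U′^{u⁻¹} = e^{iηA}`,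
restricted) — and (1.140) holds «on Ω_j» for `j ≤ k` (`B8Eq140Level.Cond140` on `pullDom Ω j`, background `U₀♯`) with `0 < α₀, α₂ ≤ 1/(80d)`: THEN
`U′U₀ ∈ 𝔄_k({Ω_j}, α₀ + 3α₂)` on the torus.  Lit-balaban p40's `ℤᵈ` theorem `B8Prop7ClassAkLocal.inAk_mulCfg_gaugeAct_hermitian_loc` read through type-B8's
junction `B8Thm2SetupTorus.inSpace_iff_inAk_pull`, the locality `B8Prop3GaugeFixedKLevel.inAk_congr_of_sideTouches`, and the pointwise chart algebra above.
[cite: Balaban1985RegularSpaces, Prop. 7 (1.144) p.100, (1.7)-(1.9) p.77; Balaban1985Variational, Sect. F (168) p.304] -/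
theorem inSpace_mul_of_local_chart (k : ℕ) {η α₀ α₂ : ℝ} (hη : 0 < η)
    (hα₀ : 0 < α₀) (hα₀c : α₀ ≤ 1 / (80 * P.d)) (hα₂ : 0 < α₂) (hα₂c : α₂ ≤ 1 / (80 * P.d))
    (Ω : ℕ → Set (Site P 0)) (U₀ U' : GaugeField P 0 (Matrix.unitaryGroup (Fin N) ℂ))
    (u : GaugeTransf P 0 (Matrix.unitaryGroup (Fin N) ℂ)) (A : GaugeField P 0 (Matrix (Fin N) (Fin N) ℂ))
    (hA : ∀ b : PBond P 0, IsSelfAdjoint (A b))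
    (h139 : InSpace k Ω α₀ η U₀)
    (hchart : ∀ j, j ≤ k → ∀ (z : B7Prop1Explicit.Site P.d) (μ : Fin P.d), SideTouches (pullDom Ω j) z μ →
      mgauge (cfgPull P U₀) (gaugePull P u)⁻¹ (cfgPull P U') z μ = cfgExp η (pull A 0) z μ)
    (h140 : ∀ j, j ≤ k → Cond140 P.L η α₂ j (pullDom Ω j) (cfgPull P U₀) (pull A 0)) :
    InSpace k Ω (α₀ + 3 * α₂) η (fun b => U' b * U₀ b) := by
  letI : CStarAlgebra (Matrix (Fin N) (Fin N) ℂ) := B10Eq29TubeLine.cstarAlgebraMatrix N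
  rw [inSpace_iff_inAk_pull]
  have hmul : pull (unitsField fun b => U' b * U₀ b) 0 = mulCfg (cfgPull P U') (cfgPull P U₀) := cfgPull_mul U' U₀
  rw [hmul]
  -- replace `U′♯U₀♯` by `(e^{iηA♯}U₀♯)^{u♯}` on the reading layers
  have hloc : ∀ j, j ≤ k → ∀ y τ, SideTouches (pullDom Ω j) y τ →
      mulCfg (cfgPull P U') (cfgPull P U₀) y τ = gaugeAct (gaugePull P u) (mulCfg (expCfg (iEta η (pull A 0))) (cfgPull P U₀)) y τ := by
    intro j hj y τ hy
    rw [expCfg_iEta_eq_cfgExp, mulCfg_apply_eq_gaugeAct_of_mgauge_apply_eq (hchart j hj y τ hy), inv_inv]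
  rw [inAk_congr_of_sideTouches P.L k η (α₀ + 3 * α₂) hloc]
  have hL : 1 ≤ P.L := P.L_pos
  have h₀ : ∀ y κ, cfgPull P U₀ y κ ∈ U1 (Matrix (Fin N) (Fin N) ℂ) := fun y κ => unitaryUnits_le_U1 (cfgPull_mem U₀ y κ)
  have hu1 : ∀ x, gaugePull P u x ∈ U1 (Matrix (Fin N) (Fin N) ℂ) := fun x => unitaryUnits_le_U1 (gaugePull_mem u x)
  have hAh : ∀ y κ, IsSelfAdjoint (pull A 0 y κ) := fun y κ => hA _
  have h139' : InAk P.L k η α₀ (pullDom Ω) (cfgPull P U₀) := (inSpace_iff_inAk_pull k Ω α₀ η U₀).1 h139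
  exact inAk_mulCfg_gaugeAct_hermitian_loc hη hL h₀ hAh hα₀.le hα₀c hα₂.le hα₂c h139' h140 hu1

/-- **THE FLAT-BACKGROUND CASE** ([Balaban1985Variational] Sect. F's first case, `U₀ = 1` after the generalized axial gauge (145)–(146)): if on the reading layers of
the pulled-back domains the gauge-fixed configuration is `e^{iηA}` — `mgauge 1 (u♯)⁻¹ (U♯) = cfgExp η A♯` there, i.e. `U^{u⁻¹} = e^{iηA}` — and `A` satisfies (1.140) with
FLAT derivatives (`Cond140 … (cfgPull P 1) A♯`) «on Ω_j» for `j ≤ k`, `0 < α₂ ≤ 1/(80d)`, then `U ∈ 𝔄_k({Ω_j}, α₀ + 3α₂)` on the torus for EVERY `0 < α₀ ≤ 1/(80d)`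
(the trivial configuration lies in every `𝔄_k(α₀)`, `B10Eq68TorusRegularity.inSpace_one`). [cite: Balaban1985RegularSpaces, Prop. 7 (1.144) p.100; Balaban1985Variational, (152) p.302, (168) p.304] -/
theorem inSpace_of_local_chart_flat (k : ℕ) {η α₀ α₂ : ℝ} (hη : 0 < η)
    (hα₀ : 0 < α₀) (hα₀c : α₀ ≤ 1 / (80 * P.d)) (hα₂ : 0 < α₂) (hα₂c : α₂ ≤ 1 / (80 * P.d))
    (Ω : ℕ → Set (Site P 0)) (U : GaugeField P 0 (Matrix.unitaryGroup (Fin N) ℂ))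
    (u : GaugeTransf P 0 (Matrix.unitaryGroup (Fin N) ℂ)) (A : GaugeField P 0 (Matrix (Fin N) (Fin N) ℂ))
    (hA : ∀ b : PBond P 0, IsSelfAdjoint (A b))
    (hchart : ∀ j, j ≤ k → ∀ (z : B7Prop1Explicit.Site P.d) (μ : Fin P.d), SideTouches (pullDom Ω j) z μ →
      mgauge (cfgPull P 1) (gaugePull P u)⁻¹ (cfgPull P U) z μ = cfgExp η (pull A 0) z μ)
    (h140 : ∀ j, j ≤ k → Cond140 P.L η α₂ j (pullDom Ω j) (cfgPull P 1) (pull A 0)) :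
    InSpace k Ω (α₀ + 3 * α₂) η U := by
  have h := inSpace_mul_of_local_chart k hη hα₀ hα₀c hα₂ hα₂c Ω 1 U u A hA (B10Eq68TorusRegularity.inSpace_one k Ω hα₀ hη) hchart h140
  have hU : (fun b => U b * (1 : GaugeField P 0 (Matrix.unitaryGroup (Fin N) ℂ)) b) = U := funext fun b => mul_one _
  rw [hU] at h
  exact h

end Summit.QuantumFields.YangMills.Theorems.Prop7LocalChart

end
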